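import Literature.NumberTheory.Transcendental.MZVSimplexRepFubini
import Literature.NumberTheory.Transcendental.MultipleZetaValuesProofs
import Mathlib.Analysis.SpecificLimits.Normed
import Mathlib.Analysis.PSeries
import HarnessLib

/-!
# Brown's theorem on the periods of `𝔐_{0,5}`: the dihedral monomial integrals

Second companion file of the named fact
`Literature.NumberTheory.Transcendental.GenusZeroPeriodsMZV` (Brown's theorem: an absolutely
convergent cell integral of a regular function on `𝔐_{0,ℓ+3}` lies in `∑_{w ≤ ℓ} 𝒵_w`
[Brown, Ann. Sci. ÉNS 42 (2009), Thm 1.1, Cor 8.3]); `GenusZeroPeriodsMZVLowDimProofs.lean`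
proves the dimensions `ℓ = 0, 1`. This file is the analytic half of the case `ℓ = 2`
(`𝔐_{0,5}`, whose real cell is a pentagon): the EVALUATION of the basic convergent integrals.

Brown's proof of the general theorem [Brown 2009, §§7–8] first reduces an arbitrary convergent
cell integral to the *dihedral monomial* integrals `I_{S,δ}(α) = ∫ ∏ u_{ij}^{α_{ij}} ω_{S,δ}`,
`α ≥ 0` (Lemma 7.4), and then shows `I_{S,δ}(α) ∈ W^ℓ 𝒵` (Thm 8.2) by generalised
polylogarithms and Stokes' formula. For `|S| = 5` the second step is elementary and is done
here by positive series, in the coordinates `p = (y, x)` of the triangle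
`T = {0 < x < y < 1}` (`x = t₁`, `y = t₀` of the cell `KZ.openOrderedSimplex 2`): the convergent
monomials are `g = x^i y^J (1-x)^K (1-y)^l` with `i, l ≥ 0`, `i + J ≥ -1`, `K + l ≥ -1`
(`J, K ∈ ℤ`; a spanning family of the convergent integrands, cf. the companion file
`GenusZeroPeriodsMZVDimTwoProofs.lean`), and

* `integral_pow_mul_one_sub_pow` — Euler's Beta integral in product form,
  `∫₀¹ y^N (1-y)^l dy = l!/∏_{r=0}^{l}(N+r+1)`;
* `integral_triangle_monomial` — Tonelli on the triangle:
  `∫_T xⁿ y^J (1-y)^l = (1/(n+1)) · l!/∏_{r=0}^{l}(N+r+1)`, `N = n + 1 + J ≥ 0` (a rational number);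
* `tsum_prod_div_prod_mem` — the rational series lemma: for finite sets of positive shifts
  `B`, `D` with `|B| + 1 ≤ |D|` and `α ≥ 1`,
  `∑ₘ ∏_{b∈B}(m+b) / ((m+α)∏_{d∈D}(m+d)) ∈ ℚ + ℚ ζ(2)` (partial fractions; at most one double
  pole, `∑ 1/(m+α)² = ζ(2) - H⁽²⁾_{α-1}`; simple poles telescope to rationals);
* `integral_monomial_mem` — **the dihedral monomial integrals of `𝔐_{0,5}` lie in
  `ℚ + ℚ ζ(2) = ∑_{w ≤ 2} 𝒵_w`**: for `K ≥ 0` a finite binomial expansion gives a rational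
  number, for `K = -(k+1)` the negative binomial series `(1-x)^{-k-1} = ∑ⱼ C(j+k,k) xʲ`
  (monotone convergence in `ℝ≥0∞`) gives the series of the previous item with
  `B = {1,…,k}`, `D = {s+1,…,s+l+1}` (`s = i+1+J`), `α = i+1`, and `k ≤ l` is exactly
  `K + l ≥ -1`.

This is [Brown 2009, Thm 8.2] for `|S| = 5` (in a monomial basis adapted to simplicial
coordinates rather than Brown's `u_{ij}`); the individual lemmas are classical. The weight bound
is visible: a double pole, hence `ζ(2)`, occurs only through the coincidence `α ∈ D`.

References: F. Brown, *Multiple zeta values and periods of moduli spaces `𝔐̄_{0,n}`*, Ann. Sci.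
ÉNS 42 (2009) 371–489, §7.1 (eq. (7.6), Lemma 7.2), Lemma 7.4, Thm 8.2.
-/

noncomputable section

open MeasureTheory Set Filter Finset
open scoped Topology BigOperators ENNReal

namespace Literature.NumberTheory.Transcendental

namespace GenusZeroPeriodsMZV


/-! ### The target space `∑_{w ≤ 2} 𝒵_w = ℚ + ℚ ζ(2)` -/

/-- Rational numbers lie in `∑_{w ≤ n} 𝒵_w` (through `𝒵₀ = ℚ`). [folklore] -/
theorem ratCast_mem_iSup_mzvSpace (q : ℚ) (n : ℕ) :
    (q : ℝ) ∈ ⨆ (w : ℕ) (_ : w ≤ n), mzvSpace w := by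
  have h0 : (q : ℝ) ∈ mzvSpace 0 := by
    rw [mzvSpace_zero_eq, ← Rat.smul_one_eq_cast]
    exact Submodule.smul_mem _ q (Submodule.subset_span rfl)
  exact le_iSup₂ (f := fun (w : ℕ) (_ : w ≤ n) => mzvSpace w) 0 (Nat.zero_le n) h0

/-- `ζ(2) ∈ ∑_{w ≤ 2} 𝒵_w`. [folklore] -/
theorem multipleZeta_two_mem_iSup_mzvSpace :
    multipleZeta [2] ∈ ⨆ (w : ℕ) (_ : w ≤ 2), mzvSpace w := by
  have h2 : multipleZeta [2] ∈ mzvSpace 2 := by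
    rw [mzvSpace_two_eq]
    exact Submodule.subset_span rfl
  exact le_iSup₂ (f := fun (w : ℕ) (_ : w ≤ 2) => mzvSpace w) 2 le_rfl h2

/-- `∑_{w ≤ 2} 𝒵_w` is stable under multiplication by rational numbers. [folklore] -/
theorem ratCast_mul_mem_iSup_mzvSpace (q : ℚ) {x : ℝ} {n : ℕ}
    (hx : x ∈ ⨆ (w : ℕ) (_ : w ≤ n), mzvSpace w) :
    (q : ℝ) * x ∈ ⨆ (w : ℕ) (_ : w ≤ n), mzvSpace w := by
  rw [← Rat.smul_def]
  exact Submodule.smul_mem _ q hx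

/-! ### Rational series `∑ₘ ∏(m + b) / ((m + α) ∏(m + d))`

The general term of the series that evaluate the dihedral monomial integrals of `𝔐_{0,5}`: a
quotient of products of shifted integers, denominators of degree at least two more than
numerators, the shifts `d ∈ D` distinct and `α` arbitrary (so at most one double pole). -/

/-- The general term is nonnegative. [folklore] -/
theorem term_nonneg (B D : Finset ℕ) (α m : ℕ) :
    0 ≤ (∏ b ∈ B, ((m : ℝ) + b)) / (((m : ℝ) + α) * ∏ d ∈ D, ((m : ℝ) + d)) := by
  positivity

/-- Crude bound: `∏_B (m + b) / ((m + α) ∏_D (m + d)) ≤ (∏_B (b + 1)) / (m + 1)²` as soon as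
`|B| + 1 ≤ |D|` and all shifts `α, d ≥ 1`. [folklore] -/
theorem term_le (B D : Finset ℕ) {α : ℕ} (hα : 1 ≤ α) (hD : ∀ d ∈ D, 1 ≤ d)
    (hcard : B.card + 1 ≤ D.card) (m : ℕ) :
    (∏ b ∈ B, ((m : ℝ) + b)) / (((m : ℝ) + α) * ∏ d ∈ D, ((m : ℝ) + d)) ≤
      (∏ b ∈ B, ((b : ℝ) + 1)) / ((m : ℝ) + 1) ^ 2 := by
  have hm1 : (0 : ℝ) < (m : ℝ) + 1 := by positivity
  have hnum : ∏ b ∈ B, ((m : ℝ) + b) ≤ ((m : ℝ) + 1) ^ B.card * ∏ b ∈ B, ((b : ℝ) + 1) := by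
    rw [← prod_const, ← prod_mul_distrib]
    refine prod_le_prod (fun b _ => by positivity) fun b _ => ?_
    have hm : (0 : ℝ) ≤ m := Nat.cast_nonneg m
    have hb : (0 : ℝ) ≤ b := Nat.cast_nonneg b
    nlinarith [mul_nonneg hm hb]
  have hden : ((m : ℝ) + 1) ^ (D.card + 1) ≤ ((m : ℝ) + α) * ∏ d ∈ D, ((m : ℝ) + d) := by
    rw [pow_succ, mul_comm, ← prod_const]
    refine mul_le_mul ?_ (prod_le_prod (fun _ _ => hm1.le) fun d hd => ?_) ?_ (by positivity)
    · have : (1 : ℝ) ≤ α := by exact_mod_cast hα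
      linarith
    · have : (1 : ℝ) ≤ d := by exact_mod_cast hD d hd
      linarith
    · positivity
  have hden_pos : 0 < ((m : ℝ) + α) * ∏ d ∈ D, ((m : ℝ) + d) :=
    lt_of_lt_of_le (by positivity) hden
  rw [div_le_div_iff₀ hden_pos (by positivity)]
  calc (∏ b ∈ B, ((m : ℝ) + b)) * ((m : ℝ) + 1) ^ 2
      ≤ (((m : ℝ) + 1) ^ B.card * ∏ b ∈ B, ((b : ℝ) + 1)) * ((m : ℝ) + 1) ^ 2 :=
        mul_le_mul_of_nonneg_right hnum (by positivity)
    _ = (∏ b ∈ B, ((b : ℝ) + 1)) * ((m : ℝ) + 1) ^ (B.card + 2) := by ring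
    _ ≤ (∏ b ∈ B, ((b : ℝ) + 1)) * ((m : ℝ) + 1) ^ (D.card + 1) := by
        refine mul_le_mul_of_nonneg_left ?_ (by positivity)
        exact pow_le_pow_right₀ (by linarith) (by omega)
    _ ≤ (∏ b ∈ B, ((b : ℝ) + 1)) * (((m : ℝ) + α) * ∏ d ∈ D, ((m : ℝ) + d)) :=
        mul_le_mul_of_nonneg_left hden (by positivity)

/-- The series `∑ₘ ∏_B (m + b) / ((m + α) ∏_D (m + d))` converges when `|B| + 1 ≤ |D|`
(comparison with `∑ 1/(m+1)²`). [folklore] -/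
theorem summable_term (B D : Finset ℕ) {α : ℕ} (hα : 1 ≤ α) (hD : ∀ d ∈ D, 1 ≤ d)
    (hcard : B.card + 1 ≤ D.card) :
    Summable fun m : ℕ =>
      (∏ b ∈ B, ((m : ℝ) + b)) / (((m : ℝ) + α) * ∏ d ∈ D, ((m : ℝ) + d)) := by
  have hs : Summable fun m : ℕ => (∏ b ∈ B, ((b : ℝ) + 1)) / ((m : ℝ) + 1) ^ 2 := by
    have h1 : Summable fun m : ℕ => 1 / ((m : ℝ) + 1) ^ 2 := by
      have h := (summable_nat_add_iff 1).mpr (Real.summable_one_div_nat_pow.mpr one_lt_two)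
      simp only [Nat.cast_add, Nat.cast_one] at h
      exact h
    refine (h1.mul_left (∏ b ∈ B, ((b : ℝ) + 1))).congr fun m => ?_
    exact mul_one_div _ _
  exact Summable.of_nonneg_of_le (fun m => term_nonneg B D α m) (term_le B D hα hD hcard) hs

/-- Telescoping: `∑ₘ 1/((m + α)(m + α + p)) = (1/p) ∑_{j < p} 1/(j + α)` for `p, α ≥ 1`.
[folklore] -/
theorem hasSum_inv_mul_inv_add (α p : ℕ) (hα : 1 ≤ α) (hp : 1 ≤ p) :
    HasSum (fun m : ℕ => 1 / (((m : ℝ) + α) * ((m : ℝ) + α + p)))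
      ((1 / (p : ℝ)) * ∑ j ∈ range p, 1 / ((j : ℝ) + α)) := by
  obtain ⟨f, hf⟩ : ∃ f : ℕ → ℝ, f = fun m : ℕ => 1 / ((m : ℝ) + α) := ⟨_, rfl⟩
  have hterm : ∀ m : ℕ, 1 / (((m : ℝ) + α) * ((m : ℝ) + α + p)) =
      (1 / (p : ℝ)) * (f m - f (p + m)) := by
    intro m
    have h1 : (0 : ℝ) < (m : ℝ) + α := by positivity
    have h3 : (0 : ℝ) < p := by positivity
    simp only [hf, Nat.cast_add]
    field_simp
    ring
  have hpartial : ∀ N : ℕ, ∑ m ∈ range N, (f m - f (p + m)) =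
      ∑ j ∈ range p, f j - ∑ j ∈ range p, f (N + j) := by
    intro N
    have hA := sum_range_add f N p
    have hB := sum_range_add f p N
    rw [add_comm p N, hA] at hB
    rw [sum_sub_distrib]
    linarith
  have hf0 : ∀ j : ℕ, Tendsto (fun N : ℕ => f (N + j)) atTop (𝓝 0) := by
    intro j
    have : Tendsto (fun N : ℕ => ((N : ℝ) + j) + α) atTop atTop :=
      tendsto_atTop_add_const_right _ _
        (tendsto_atTop_add_const_right _ _ tendsto_natCast_atTop_atTop)
    simpa [hf, Nat.cast_add, Function.comp_def] using tendsto_inv_atTop_zero.comp this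
  have hlim : Tendsto (fun N : ℕ => ∑ m ∈ range N, 1 / (((m : ℝ) + α) * ((m : ℝ) + α + p)))
      atTop (𝓝 ((1 / (p : ℝ)) * (∑ j ∈ range p, f j - ∑ j ∈ range p, (0 : ℝ)))) := by
    simp_rw [hterm, ← mul_sum, hpartial]
    exact Tendsto.const_mul _ (tendsto_const_nhds.sub (tendsto_finsetSum _ fun j _ => hf0 j))
  simp only [sum_const_zero, sub_zero, hf] at hlim
  refine (hasSum_iff_tendsto_nat_of_nonneg (fun m => ?_) _).2 hlim
  positivity

/-- `∑ₘ 1/(m+1)²` converges. [folklore] -/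
theorem summable_one_div_nat_add_one_sq : Summable fun m : ℕ => 1 / ((m : ℝ) + 1) ^ 2 := by
  have h := (summable_nat_add_iff 1).mpr (Real.summable_one_div_nat_pow.mpr one_lt_two)
  simp only [Nat.cast_add, Nat.cast_one] at h
  exact h

/-- The double pole: `∑ₘ 1/(m + α)² = ζ(2) - ∑_{n < α-1} 1/(n+1)² ∈ ℚ + ℚ ζ(2)` (`α ≥ 1`).
[folklore] -/
theorem tsum_inv_mul_self_mem (α : ℕ) (hα : 1 ≤ α) :
    (∑' m : ℕ, 1 / (((m : ℝ) + α) * ((m : ℝ) + α))) ∈ ⨆ (w : ℕ) (_ : w ≤ 2), mzvSpace w := by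
  have hζ : multipleZeta [2] = ∑' n : ℕ, 1 / ((n : ℝ) + 1) ^ 2 :=
    multipleZeta_singleton_holds le_rfl
  have hsplit := summable_one_div_nat_add_one_sq.sum_add_tsum_nat_add (α - 1)
  have hshift : (fun i : ℕ => 1 / (((i + (α - 1) : ℕ) : ℝ) + 1) ^ 2) =
      fun m : ℕ => 1 / (((m : ℝ) + α) * ((m : ℝ) + α)) := by
    funext m
    have : (((m + (α - 1) : ℕ) : ℝ) + 1) = (m : ℝ) + α := by
      push_cast [Nat.cast_sub hα]
      ring
    rw [this, pow_two]
  rw [hshift, ← hζ] at hsplit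
  have : (∑' m : ℕ, 1 / (((m : ℝ) + α) * ((m : ℝ) + α))) =
      multipleZeta [2] - ((∑ i ∈ range (α - 1), 1 / ((i : ℚ) + 1) ^ 2 : ℚ) : ℝ) := by
    push_cast
    linarith
  rw [this]
  exact sub_mem multipleZeta_two_mem_iSup_mzvSpace (ratCast_mem_iSup_mzvSpace _ 2)

/-- Two distinct simple poles: `∑ₘ 1/((m + α)(m + d)) ∈ ℚ` for `α ≠ d` (telescoping).
[folklore] -/
theorem tsum_inv_mul_inv_mem {α d : ℕ} (hα : 1 ≤ α) (hd : 1 ≤ d) (hne : α ≠ d) :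
    (∑' m : ℕ, 1 / (((m : ℝ) + α) * ((m : ℝ) + d))) ∈ ⨆ (w : ℕ) (_ : w ≤ 2), mzvSpace w := by
  -- arrange `α < d`, the term being symmetric
  wlog hlt : α < d generalizing α d
  · have h := this hd hα (Ne.symm hne) (lt_of_le_of_ne (not_lt.1 hlt) (Ne.symm hne))
    simpa only [mul_comm] using h
  obtain ⟨p, rfl⟩ : ∃ p, d = α + p := ⟨d - α, by omega⟩
  have hp : 1 ≤ p := by omega
  have h := hasSum_inv_mul_inv_add α p hα hp
  have hcast : ∀ m : ℕ, ((m : ℝ) + ((α + p : ℕ) : ℝ)) = (m : ℝ) + α + p := by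
    intro m; push_cast; ring
  simp_rw [hcast]
  rw [h.tsum_eq]
  have : (1 / (p : ℝ)) * ∑ j ∈ range p, 1 / ((j : ℝ) + α) =
      (((1 / (p : ℚ)) * ∑ j ∈ range p, 1 / ((j : ℚ) + α) : ℚ) : ℝ) := by
    push_cast
    rfl
  rw [this]
  exact ratCast_mem_iSup_mzvSpace _ 2

/-- **Numerator-free sums.** For `D` a nonempty finite set of positive shifts and `α ≥ 1`,
`∑ₘ 1/((m + α) ∏_{d ∈ D} (m + d)) ∈ ℚ + ℚ ζ(2)`: partial fractions in two distinct shifts of `D`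
reduce `|D|` (`1/((m+d₁)(m+d₂)) = (1/(d₂-d₁)) (1/(m+d₁) - 1/(m+d₂))`), down to `|D| = 1`, a
telescoping sum or `∑ 1/(m+α)²`. [folklore] -/
theorem tsum_inv_prod_mem (n : ℕ) : ∀ (D : Finset ℕ), D.card = n + 1 → (∀ d ∈ D, 1 ≤ d) →
    ∀ α : ℕ, 1 ≤ α →
    (∑' m : ℕ, 1 / (((m : ℝ) + α) * ∏ d ∈ D, ((m : ℝ) + d))) ∈
      ⨆ (w : ℕ) (_ : w ≤ 2), mzvSpace w := by
  induction n with
  | zero =>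
    intro D hD hD1 α hα
    obtain ⟨d, rfl⟩ := card_eq_one.1 hD
    simp only [Finset.prod_singleton]
    have hd : 1 ≤ d := hD1 d (mem_singleton_self d)
    rcases eq_or_ne α d with rfl | hne
    · exact tsum_inv_mul_self_mem α hα
    · exact tsum_inv_mul_inv_mem hα hd hne
  | succ n ih =>
    intro D hD hD1 α hα
    obtain ⟨d₁, d₂, hd₁, hd₂, hne⟩ := one_lt_card_iff.1 (by omega : 1 < D.card)
    have hc₁ : (D.erase d₁).card = n + 1 := by rw [card_erase_of_mem hd₁]; omega
    have hc₂ : (D.erase d₂).card = n + 1 := by rw [card_erase_of_mem hd₂]; omega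
    have h₁ := ih (D.erase d₁) hc₁ (fun d hd => hD1 d (mem_of_mem_erase hd)) α hα
    have h₂ := ih (D.erase d₂) hc₂ (fun d hd => hD1 d (mem_of_mem_erase hd)) α hα
    have hs₁ : Summable fun m : ℕ =>
        1 / (((m : ℝ) + α) * ∏ d ∈ D.erase d₁, ((m : ℝ) + d)) := by
      simpa using summable_term ∅ (D.erase d₁) hα (fun d hd => hD1 d (mem_of_mem_erase hd))
        (by simp [hc₁])
    have hs₂ : Summable fun m : ℕ =>
        1 / (((m : ℝ) + α) * ∏ d ∈ D.erase d₂, ((m : ℝ) + d)) := by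
      simpa using summable_term ∅ (D.erase d₂) hα (fun d hd => hD1 d (mem_of_mem_erase hd))
        (by simp [hc₂])
    -- the partial fraction identity, termwise, with `Q = ∏ over D minus {d₁, d₂}`
    have hpf : ∀ m : ℕ, 1 / (((m : ℝ) + α) * ∏ d ∈ D, ((m : ℝ) + d)) =
        (((1 / ((d₂ : ℚ) - d₁) : ℚ) : ℝ)) *
          (1 / (((m : ℝ) + α) * ∏ d ∈ D.erase d₂, ((m : ℝ) + d)) -
            1 / (((m : ℝ) + α) * ∏ d ∈ D.erase d₁, ((m : ℝ) + d))) := by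
      intro m
      have hd₂' : d₂ ∈ D.erase d₁ := mem_erase.2 ⟨Ne.symm hne, hd₂⟩
      have hd₁' : d₁ ∈ D.erase d₂ := mem_erase.2 ⟨hne, hd₁⟩
      have hP : ∏ d ∈ D, ((m : ℝ) + d) =
          ((m : ℝ) + d₁) * (((m : ℝ) + d₂) * ∏ d ∈ (D.erase d₁).erase d₂, ((m : ℝ) + d)) := by
        rw [mul_prod_erase (D.erase d₁) (fun d => (m : ℝ) + d) hd₂',
          mul_prod_erase D (fun d => (m : ℝ) + d) hd₁]
      have hP₁ : ∏ d ∈ D.erase d₁, ((m : ℝ) + d) =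
          ((m : ℝ) + d₂) * ∏ d ∈ (D.erase d₁).erase d₂, ((m : ℝ) + d) :=
        (mul_prod_erase (D.erase d₁) (fun d => (m : ℝ) + d) hd₂').symm
      have hP₂ : ∏ d ∈ D.erase d₂, ((m : ℝ) + d) =
          ((m : ℝ) + d₁) * ∏ d ∈ (D.erase d₁).erase d₂, ((m : ℝ) + d) := by
        rw [← mul_prod_erase (D.erase d₂) (fun d => (m : ℝ) + d) hd₁', erase_right_comm]
      set Q := ∏ d ∈ (D.erase d₁).erase d₂, ((m : ℝ) + d) with hQ
      have hQ0 : (0 : ℝ) < Q := prod_pos fun d hd => by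
        have := hD1 d (mem_of_mem_erase (mem_of_mem_erase hd))
        positivity
      have hα0 : (0 : ℝ) < (m : ℝ) + α := by positivity
      have hm₁ : (0 : ℝ) < (m : ℝ) + d₁ := by have := hD1 d₁ hd₁; positivity
      have hm₂ : (0 : ℝ) < (m : ℝ) + d₂ := by have := hD1 d₂ hd₂; positivity
      have hne' : (d₂ : ℝ) - d₁ ≠ 0 := sub_ne_zero.2 (by exact_mod_cast (Ne.symm hne))
      rw [hP, hP₁, hP₂]
      push_cast
      field_simp
      ring
    rw [tsum_congr hpf, tsum_mul_left, hs₂.tsum_sub hs₁]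
    exact ratCast_mul_mem_iSup_mzvSpace _ (sub_mem h₂ h₁)

/-- **The rational series lemma.** For finite sets of shifts `B` (numerator) and `D`
(denominator, positive) with `|B| + 1 ≤ |D|`, and any `α ≥ 1`,
`∑ₘ ∏_{b∈B}(m+b) / ((m+α) ∏_{d∈D}(m+d)) ∈ ℚ + ℚ ζ(2) = ∑_{w ≤ 2} 𝒵_w`.
Reduction of the numerator: `(m+b)/(m+d) = 1 + (b-d)/(m+d)`; then `tsum_inv_prod_mem`.
(These are the values of the dihedral monomial integrals of `𝔐_{0,5}`, [Brown 2009, Thm 8.2]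
for `|S| = 5`; the lemma itself is elementary.) [folklore] -/
theorem tsum_prod_div_prod_mem (s : ℕ) : ∀ (B D : Finset ℕ), B.card = s → s + 1 ≤ D.card →
    (∀ d ∈ D, 1 ≤ d) → ∀ α : ℕ, 1 ≤ α →
    (∑' m : ℕ, (∏ b ∈ B, ((m : ℝ) + b)) / (((m : ℝ) + α) * ∏ d ∈ D, ((m : ℝ) + d))) ∈
      ⨆ (w : ℕ) (_ : w ≤ 2), mzvSpace w := by
  induction s with
  | zero =>
    intro B D hB hBD hD1 α hα
    rw [card_eq_zero.1 hB]
    simp only [Finset.prod_empty]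
    obtain ⟨n, hn⟩ : ∃ n, D.card = n + 1 := ⟨D.card - 1, by omega⟩
    exact tsum_inv_prod_mem n D hn hD1 α hα
  | succ s ih =>
    intro B D hB hBD hD1 α hα
    obtain ⟨b, hb⟩ : B.Nonempty := card_pos.1 (by omega)
    obtain ⟨d, hd⟩ : D.Nonempty := card_pos.1 (by omega)
    have hB' : (B.erase b).card = s := by rw [card_erase_of_mem hb, hB]; rfl
    have hD' : (D.erase d).card = D.card - 1 := card_erase_of_mem hd
    have hD1' : ∀ x ∈ D.erase d, 1 ≤ x := fun x hx => hD1 x (mem_of_mem_erase hx)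
    have h₁ := ih (B.erase b) (D.erase d) hB' (by omega) hD1' α hα
    have h₂ := ih (B.erase b) D hB' (by omega) hD1 α hα
    have hs₁ := summable_term (B.erase b) (D.erase d) hα hD1' (by omega)
    have hs₂ := summable_term (B.erase b) D hα hD1 (by omega)
    have hpf : ∀ m : ℕ, (∏ x ∈ B, ((m : ℝ) + x)) / (((m : ℝ) + α) * ∏ x ∈ D, ((m : ℝ) + x)) =
        (∏ x ∈ B.erase b, ((m : ℝ) + x)) / (((m : ℝ) + α) * ∏ x ∈ D.erase d, ((m : ℝ) + x)) +
          ((((b : ℚ) - d : ℚ)) : ℝ) *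
            ((∏ x ∈ B.erase b, ((m : ℝ) + x)) / (((m : ℝ) + α) * ∏ x ∈ D, ((m : ℝ) + x))) := by
      intro m
      rw [← mul_prod_erase B (fun x => (m : ℝ) + x) hb, ← mul_prod_erase D (fun x => (m : ℝ) + x) hd]
      have hα0 : (0 : ℝ) < (m : ℝ) + α := by positivity
      have hmd : (0 : ℝ) < (m : ℝ) + d := by have := hD1 d hd; positivity
      have hE : (0 : ℝ) < ∏ x ∈ D.erase d, ((m : ℝ) + x) := prod_pos fun x hx => by
        have := hD1' x hx
        positivity
      push_cast
      field_simp
      ring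
    rw [tsum_congr hpf, hs₁.tsum_add (hs₂.mul_left _), tsum_mul_left]
    exact add_mem h₁ (ratCast_mul_mem_iSup_mzvSpace _ h₂)



/-! ### Beta integrals `∫₀¹ y^N (1-y)^l dy = l! / ((N+1)(N+2)⋯(N+l+1))` -/

/-- Euler's Beta integral at integers, in product form:
`∫₀¹ y^N (1-y)^l dy = l! / ∏_{r=0}^{l} (N + r + 1)`, by the recursion
`y^N (1-y)^{l+1} = y^N (1-y)^l - y^{N+1} (1-y)^l`. [folklore] -/
theorem integral_pow_mul_one_sub_pow (l : ℕ) : ∀ N : ℕ,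
    ∫ y in (0 : ℝ)..1, y ^ N * (1 - y) ^ l =
      (l.factorial : ℝ) / ∏ r ∈ range (l + 1), ((N : ℝ) + r + 1) := by
  induction l with
  | zero =>
    intro N
    simp [integral_pow]
  | succ l ih =>
    intro N
    have hsplit : (fun y : ℝ => y ^ N * (1 - y) ^ (l + 1)) =
        fun y => y ^ N * (1 - y) ^ l - y ^ (N + 1) * (1 - y) ^ l := by
      funext y; ring
    have hc : ∀ a b : ℕ, IntervalIntegrable (fun y : ℝ => y ^ a * (1 - y) ^ b) volume 0 1 :=
      fun a b => (Continuous.intervalIntegrable (by fun_prop) _ _)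
    rw [hsplit, intervalIntegral.integral_sub (hc N l) (hc (N + 1) l), ih N, ih (N + 1)]
    -- the products: C = A (N+l+2) = (N+1) B
    have hCA : ∏ r ∈ range (l + 1 + 1), ((N : ℝ) + r + 1) =
        (∏ r ∈ range (l + 1), ((N : ℝ) + r + 1)) * ((N : ℝ) + l + 2) := by
      rw [prod_range_succ]
      push_cast
      ring
    have hCB : ∏ r ∈ range (l + 1 + 1), ((N : ℝ) + r + 1) =
        ((N : ℝ) + 1) * ∏ r ∈ range (l + 1), (((N + 1 : ℕ) : ℝ) + r + 1) := by
      rw [prod_range_succ']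
      have h1 : ∀ r : ℕ, ((N : ℝ) + ((r + 1 : ℕ) : ℝ) + 1) = (((N + 1 : ℕ) : ℝ) + r + 1) := by
        intro r; push_cast; ring
      have h2 : ((N : ℝ) + ((0 : ℕ) : ℝ) + 1) = (N : ℝ) + 1 := by push_cast; ring
      simp only [h1, h2]
      ring
    have hB0 : 0 < ∏ r ∈ range (l + 1), (((N + 1 : ℕ) : ℝ) + r + 1) :=
      prod_pos fun r _ => by positivity
    have hl0 : (0 : ℝ) < (N : ℝ) + l + 2 := by positivity
    have hkey : (∏ r ∈ range (l + 1), ((N : ℝ) + r + 1)) =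
        ((N : ℝ) + 1) * (∏ r ∈ range (l + 1), (((N + 1 : ℕ) : ℝ) + r + 1)) /
          ((N : ℝ) + l + 2) := by
      rw [eq_div_iff hl0.ne', ← hCA, hCB]
    rw [hCB, hkey]
    field_simp
    push_cast [Nat.factorial_succ]
    ring

/-- The Beta values are positive rationals: explicit cast form. [folklore] -/
theorem beta_eq_ratCast (l N : ℕ) :
    (l.factorial : ℝ) / ∏ r ∈ range (l + 1), ((N : ℝ) + r + 1) =
      (((l.factorial : ℚ) / ∏ r ∈ range (l + 1), ((N : ℚ) + r + 1) : ℚ) : ℝ) := by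
  push_cast
  rfl

/-! ### The triangle `T = {0 < x < y < 1}` (coordinates `p = (y, x)`) and its monomials -/

/-- The open triangle `{(y, x) | 0 < x < y < 1}` is measurable. [folklore] -/
theorem measurableSet_triangle :
    MeasurableSet {p : ℝ × ℝ | 0 < p.2 ∧ p.2 < p.1 ∧ p.1 < 1} := by
  refine (measurableSet_lt measurable_const measurable_snd).inter
    ((measurableSet_lt measurable_snd measurable_fst).inter
      (measurableSet_lt measurable_fst measurable_const))

/-- The open triangle is an open set. [folklore] -/
theorem isOpen_triangle : IsOpen {p : ℝ × ℝ | 0 < p.2 ∧ p.2 < p.1 ∧ p.1 < 1} := by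
  refine (isOpen_lt continuous_const continuous_snd).inter
    ((isOpen_lt continuous_snd continuous_fst).inter (isOpen_lt continuous_fst continuous_const))

/-- **Tonelli for a separated monomial on the triangle.**
`∫⁻_{0<x<y<1} xⁿ y^J (1-y)^l = (1/(n+1)) ∫₀¹ y^N (1-y)^l` in `ℝ≥0∞`, where `N = n + 1 + J ≥ 0`:
the inner integral is `∫₀^y xⁿ dx = y^{n+1}/(n+1)`. [folklore] -/
theorem lintegral_triangle_monomial (n l N : ℕ) (J : ℤ) (hN : (N : ℤ) = n + 1 + J) :
    ∫⁻ p in {p : ℝ × ℝ | 0 < p.2 ∧ p.2 < p.1 ∧ p.1 < 1},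
        ENNReal.ofReal (p.2 ^ n * p.1 ^ J * (1 - p.1) ^ l) =
      ENNReal.ofReal ((1 / ((n : ℝ) + 1)) *
        ((l.factorial : ℝ) / ∏ r ∈ range (l + 1), ((N : ℝ) + r + 1))) := by
  set F : ℝ × ℝ → ℝ≥0∞ := fun p => ENNReal.ofReal (p.2 ^ n * p.1 ^ J * (1 - p.1) ^ l) with hF
  have hFm : Measurable F := by
    refine ENNReal.measurable_ofReal.comp ?_
    exact ((measurable_snd.pow_const n).mul (measurable_fst.pow_const J)).mul
      ((measurable_const.sub measurable_fst).pow_const l)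
  -- the slices
  have hslice : ∀ y : ℝ, ∫⁻ x, ({p : ℝ × ℝ | 0 < p.2 ∧ p.2 < p.1 ∧ p.1 < 1} : Set (ℝ × ℝ)).indicator F (y, x) =
      (Ioo (0 : ℝ) 1).indicator
        (fun y => ENNReal.ofReal (y ^ J * (1 - y) ^ l * (y ^ (n + 1) / (n + 1)))) y := by
    intro y
    by_cases hy : y ∈ Ioo (0 : ℝ) 1
    · have hyJ : 0 ≤ y ^ J * (1 - y) ^ l :=
        mul_nonneg (zpow_nonneg hy.1.le _) (pow_nonneg (by linarith [hy.2]) _)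
      have hind : ∀ x, ({p : ℝ × ℝ | 0 < p.2 ∧ p.2 < p.1 ∧ p.1 < 1} : Set (ℝ × ℝ)).indicator F (y, x) =
          (Ioo 0 y).indicator (fun x => ENNReal.ofReal (y ^ J * (1 - y) ^ l) *
            ENNReal.ofReal (x ^ n)) x := by
        intro x
        by_cases hx : x ∈ Ioo 0 y
        · have hmem : (y, x) ∈ ({p : ℝ × ℝ | 0 < p.2 ∧ p.2 < p.1 ∧ p.1 < 1} : Set (ℝ × ℝ)) := ⟨hx.1, hx.2, hy.2⟩
          rw [indicator_of_mem hmem, indicator_of_mem hx, hF, ← ENNReal.ofReal_mul hyJ]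
          ring_nf
        · have hnmem : (y, x) ∉ ({p : ℝ × ℝ | 0 < p.2 ∧ p.2 < p.1 ∧ p.1 < 1} : Set (ℝ × ℝ)) := fun h => hx ⟨h.1, h.2.1⟩
          rw [indicator_of_notMem hnmem, indicator_of_notMem hx]
      simp_rw [hind]
      rw [lintegral_indicator measurableSet_Ioo,
        lintegral_const_mul _ (KZ.MZVSimplex.measurable_ofReal_pow n),
        KZ.MZVSimplex.lintegral_pow_Ioo n hy.1.le, indicator_of_mem hy,
        ← ENNReal.ofReal_mul hyJ]
    · have hind : ∀ x, ({p : ℝ × ℝ | 0 < p.2 ∧ p.2 < p.1 ∧ p.1 < 1} : Set (ℝ × ℝ)).indicator F (y, x) = 0 := by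
        intro x
        refine indicator_of_notMem (fun h => hy ⟨?_, h.2.2⟩) _
        exact h.1.trans h.2.1
      simp_rw [hind]
      rw [lintegral_zero, indicator_of_notMem hy]
  rw [← lintegral_indicator measurableSet_triangle, Measure.volume_eq_prod,
    lintegral_prod _ ((hFm.indicator measurableSet_triangle).aemeasurable)]
  simp_rw [hslice]
  rw [lintegral_indicator measurableSet_Ioo]
  -- the outer integral
  have hcongr : ∀ y ∈ Ioo (0 : ℝ) 1,
      ENNReal.ofReal (y ^ J * (1 - y) ^ l * (y ^ (n + 1) / (n + 1))) =
        ENNReal.ofReal ((1 / ((n : ℝ) + 1)) * (y ^ N * (1 - y) ^ l)) := by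
    intro y hy
    have hyN : y ^ N = y ^ J * y ^ (n + 1) := by
      rw [← zpow_natCast, hN, show (n : ℤ) + 1 + J = J + ((n + 1 : ℕ) : ℤ) by push_cast; ring,
        zpow_add₀ hy.1.ne', zpow_natCast]
    rw [hyN]
    ring
  rw [setLIntegral_congr_fun measurableSet_Ioo hcongr]
  have hint : IntegrableOn (fun y : ℝ => (1 / ((n : ℝ) + 1)) * (y ^ N * (1 - y) ^ l))
      (Ioo (0 : ℝ) 1) volume :=
    (Continuous.integrableOn_Icc (by fun_prop)).mono_set Ioo_subset_Icc_self
  have hnn : 0 ≤ᵐ[volume.restrict (Ioo (0 : ℝ) 1)]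
      fun y : ℝ => (1 / ((n : ℝ) + 1)) * (y ^ N * (1 - y) ^ l) :=
    (ae_restrict_iff' measurableSet_Ioo).2 (ae_of_all _ fun y hy =>
      mul_nonneg (by positivity) (mul_nonneg (pow_nonneg hy.1.le _)
        (pow_nonneg (by linarith [hy.2]) _)))
  rw [← ofReal_integral_eq_lintegral_ofReal hint hnn, ← integral_Ioc_eq_integral_Ioo,
    ← intervalIntegral.integral_of_le zero_le_one, intervalIntegral.integral_const_mul,
    integral_pow_mul_one_sub_pow l N]

/-- **The separated monomials are integrable on the triangle, with rational integral**
`∫_{0<x<y<1} xⁿ y^J (1-y)^l dx dy = (1/(n+1)) · l!/∏_{r=0}^{l}(N + r + 1)`, `N = n + 1 + J ≥ 0`.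
[folklore] -/
theorem integral_triangle_monomial (n l N : ℕ) (J : ℤ) (hN : (N : ℤ) = n + 1 + J) :
    IntegrableOn (fun p : ℝ × ℝ => p.2 ^ n * p.1 ^ J * (1 - p.1) ^ l)
        {p : ℝ × ℝ | 0 < p.2 ∧ p.2 < p.1 ∧ p.1 < 1} volume ∧
      ∫ p in {p : ℝ × ℝ | 0 < p.2 ∧ p.2 < p.1 ∧ p.1 < 1}, p.2 ^ n * p.1 ^ J * (1 - p.1) ^ l =
        (1 / ((n : ℝ) + 1)) * ((l.factorial : ℝ) / ∏ r ∈ range (l + 1), ((N : ℝ) + r + 1)) := by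
  set T := {p : ℝ × ℝ | 0 < p.2 ∧ p.2 < p.1 ∧ p.1 < 1} with hT
  have hmeas : AEStronglyMeasurable (fun p : ℝ × ℝ => p.2 ^ n * p.1 ^ J * (1 - p.1) ^ l)
      (volume.restrict T) := by
    refine (Measurable.aestronglyMeasurable ?_)
    exact ((measurable_snd.pow_const n).mul (measurable_fst.pow_const J)).mul
      ((measurable_const.sub measurable_fst).pow_const l)
  have hnn : 0 ≤ᵐ[volume.restrict T] fun p : ℝ × ℝ => p.2 ^ n * p.1 ^ J * (1 - p.1) ^ l :=
    (ae_restrict_iff' measurableSet_triangle).2 (ae_of_all _ fun p hp =>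
      mul_nonneg (mul_nonneg (pow_nonneg hp.1.le _) (zpow_nonneg (hp.1.trans hp.2.1).le _))
        (pow_nonneg (by linarith [hp.2.2]) _))
  have hl := lintegral_triangle_monomial n l N J hN
  refine ⟨⟨hmeas, (hasFiniteIntegral_iff_ofReal hnn).2 (by rw [hl]; exact ENNReal.ofReal_lt_top)⟩,
    ?_⟩
  rw [integral_eq_lintegral_of_nonneg_ae hnn hmeas, hl, ENNReal.toReal_ofReal]
  positivity


/-! ### The dihedral monomials `x^i y^J (1-x)^K (1-y)^l` of `𝔐_{0,5}` -/

/-- Finite binomial expansion (case `K = k ≥ 0`):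
`x^i y^J (1-x)^k (1-y)^l = ∑_{j ≤ k} (-1)^j C(k,j) · x^{i+j} y^J (1-y)^l`. [folklore] -/
theorem monomial_eq_sum (i l k : ℕ) (J : ℤ) (p : ℝ × ℝ) :
    p.2 ^ i * p.1 ^ J * (1 - p.2) ^ ((k : ℕ) : ℤ) * (1 - p.1) ^ l =
      ∑ j ∈ range (k + 1), ((-1 : ℝ) ^ j * (k.choose j : ℝ)) *
        (p.2 ^ (i + j) * p.1 ^ J * (1 - p.1) ^ l) := by
  have hk : (1 - p.2) ^ k = ∑ j ∈ range (k + 1), (-1 : ℝ) ^ j * (k.choose j : ℝ) * p.2 ^ j := by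
    rw [sub_eq_neg_add, add_pow]
    refine Finset.sum_congr rfl fun j _ => ?_
    rw [one_pow, mul_one, neg_pow]
    ring
  rw [zpow_natCast, hk, Finset.mul_sum, Finset.sum_mul]
  refine Finset.sum_congr rfl fun j _ => ?_
  ring

/-- **Dihedral monomial integrals, `K ≥ 0`.** For `i + J ≥ -1`, the monomial
`x^i y^J (1-x)^k (1-y)^l` is integrable on the triangle and its integral is a rational number
(a finite combination of the Beta-type values `integral_triangle_monomial`). [folklore] -/
theorem integral_monomial_mem_of_nonneg (i l k : ℕ) (J : ℤ) (hJ : -1 ≤ (i : ℤ) + J) :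
    IntegrableOn (fun p : ℝ × ℝ => p.2 ^ i * p.1 ^ J * (1 - p.2) ^ ((k : ℕ) : ℤ) * (1 - p.1) ^ l)
        {p : ℝ × ℝ | 0 < p.2 ∧ p.2 < p.1 ∧ p.1 < 1} volume ∧
      (∫ p in {p : ℝ × ℝ | 0 < p.2 ∧ p.2 < p.1 ∧ p.1 < 1},
          p.2 ^ i * p.1 ^ J * (1 - p.2) ^ ((k : ℕ) : ℤ) * (1 - p.1) ^ l) ∈
        ⨆ (w : ℕ) (_ : w ≤ 2), mzvSpace w := by
  obtain ⟨s, hs⟩ : ∃ s : ℕ, (s : ℤ) = i + 1 + J :=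
    ⟨(i + 1 + J).toNat, Int.toNat_of_nonneg (by omega)⟩
  have hterm : ∀ j : ℕ, IntegrableOn (fun p : ℝ × ℝ => p.2 ^ (i + j) * p.1 ^ J * (1 - p.1) ^ l)
        {p : ℝ × ℝ | 0 < p.2 ∧ p.2 < p.1 ∧ p.1 < 1} volume ∧
      ∫ p in {p : ℝ × ℝ | 0 < p.2 ∧ p.2 < p.1 ∧ p.1 < 1}, p.2 ^ (i + j) * p.1 ^ J * (1 - p.1) ^ l =
        (1 / (((i + j : ℕ) : ℝ) + 1)) *
          ((l.factorial : ℝ) / ∏ r ∈ range (l + 1), (((s + j : ℕ) : ℝ) + r + 1)) := fun j =>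
    integral_triangle_monomial (i + j) l (s + j) J (by push_cast; omega)
  have hfun : (fun p : ℝ × ℝ => p.2 ^ i * p.1 ^ J * (1 - p.2) ^ ((k : ℕ) : ℤ) * (1 - p.1) ^ l) =
      fun p => ∑ j ∈ range (k + 1), ((-1 : ℝ) ^ j * (k.choose j : ℝ)) *
        (p.2 ^ (i + j) * p.1 ^ J * (1 - p.1) ^ l) :=
    funext (monomial_eq_sum i l k J)
  rw [hfun]
  refine ⟨integrable_finsetSum _ fun j _ => (hterm j).1.const_mul _, ?_⟩
  rw [integral_finsetSum _ fun j _ => (hterm j).1.const_mul _]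
  refine Submodule.sum_mem _ fun j _ => ?_
  rw [integral_const_mul, (hterm j).2, beta_eq_ratCast]
  have : (-1 : ℝ) ^ j * (k.choose j : ℝ) * (1 / (((i + j : ℕ) : ℝ) + 1) *
      ((((l.factorial : ℚ) / ∏ r ∈ range (l + 1), (((s + j : ℕ) : ℚ) + r + 1) : ℚ) : ℝ))) =
      (((-1 : ℚ) ^ j * (k.choose j : ℚ) * (1 / (((i + j : ℕ) : ℚ) + 1) *
        ((l.factorial : ℚ) / ∏ r ∈ range (l + 1), (((s + j : ℕ) : ℚ) + r + 1))) : ℚ) : ℝ) := by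
    push_cast
    ring
  rw [this]
  exact ratCast_mem_iSup_mzvSpace _ 2

/-- The negative binomial series on the triangle (case `K = -(k+1) < 0`): for `0 < x < 1`,
`x^i y^J (1-x)^{-(k+1)} (1-y)^l = ∑ⱼ C(j+k,k) · x^{i+j} y^J (1-y)^l`. [folklore] -/
theorem hasSum_monomial (i l k : ℕ) (J : ℤ) {p : ℝ × ℝ} (hp0 : 0 < p.2) (hp1 : p.2 < 1) :
    HasSum (fun j : ℕ => ((j + k).choose k : ℝ) * (p.2 ^ (i + j) * p.1 ^ J * (1 - p.1) ^ l))
      (p.2 ^ i * p.1 ^ J * (1 - p.2) ^ (-((k + 1 : ℕ) : ℤ)) * (1 - p.1) ^ l) := by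
  have hx : ‖p.2‖ < 1 := by
    rw [Real.norm_eq_abs, abs_lt]
    constructor <;> linarith
  have h := (hasSum_choose_mul_geometric_of_norm_lt_one k hx).mul_left
    (p.2 ^ i * p.1 ^ J * (1 - p.1) ^ l)
  have heq : p.2 ^ i * p.1 ^ J * (1 - p.2) ^ (-((k + 1 : ℕ) : ℤ)) * (1 - p.1) ^ l =
      p.2 ^ i * p.1 ^ J * (1 - p.1) ^ l * (1 / (1 - p.2) ^ (k + 1)) := by
    rw [zpow_neg, zpow_natCast, one_div]
    ring
  have hfn : (fun j : ℕ => ((j + k).choose k : ℝ) * (p.2 ^ (i + j) * p.1 ^ J * (1 - p.1) ^ l)) =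
      fun n => p.2 ^ i * p.1 ^ J * (1 - p.1) ^ l * (((n + k).choose k : ℝ) * p.2 ^ n) := by
    funext j
    ring
  rw [heq, hfn]
  exact h

/-- **Dihedral monomial integrals, `K = -(k+1) < 0`.** For `i + J ≥ -1` and `k ≤ l`, the
monomial `x^i y^J (1-x)^{-(k+1)} (1-y)^l` is integrable on the triangle and its integral lies
in `ℚ + ℚ ζ(2)`: by monotone convergence (in `ℝ≥0∞`) it is the series
`∑ⱼ C(j+k,k) · (1/(i+j+1)) · l!/∏_{r=0}^{l}(s+j+r+1)`, `s = i+1+J`, which is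
`(l!/k!) ∑ⱼ ∏_{b=1}^{k}(j+b) / ((j+i+1) ∏_{r=0}^{l}(j+s+r+1))`, an instance of
`tsum_prod_div_prod_mem` (`k + 1 ≤ l + 1` shifts). [Brown 2009, Thm 8.2 for |S| = 5] [folklore] -/
theorem integral_monomial_mem_of_neg (i l k : ℕ) (J : ℤ) (hJ : -1 ≤ (i : ℤ) + J) (hkl : k ≤ l) :
    IntegrableOn (fun p : ℝ × ℝ =>
        p.2 ^ i * p.1 ^ J * (1 - p.2) ^ (-((k + 1 : ℕ) : ℤ)) * (1 - p.1) ^ l)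
        {p : ℝ × ℝ | 0 < p.2 ∧ p.2 < p.1 ∧ p.1 < 1} volume ∧
      (∫ p in {p : ℝ × ℝ | 0 < p.2 ∧ p.2 < p.1 ∧ p.1 < 1},
          p.2 ^ i * p.1 ^ J * (1 - p.2) ^ (-((k + 1 : ℕ) : ℤ)) * (1 - p.1) ^ l) ∈
        ⨆ (w : ℕ) (_ : w ≤ 2), mzvSpace w := by
  obtain ⟨s, hs⟩ : ∃ s : ℕ, (s : ℤ) = i + 1 + J :=
    ⟨(i + 1 + J).toNat, Int.toNat_of_nonneg (by omega)⟩
  -- the basic integrals `q j = ∫_T x^{i+j} y^J (1-y)^l`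
  obtain ⟨q, hq⟩ : ∃ q : ℕ → ℝ, ∀ j, q j = (1 / (((i + j : ℕ) : ℝ) + 1)) *
      ((l.factorial : ℝ) / ∏ r ∈ range (l + 1), (((s + j : ℕ) : ℝ) + r + 1)) := ⟨_, fun j => rfl⟩
  have hq0 : ∀ j, 0 ≤ q j := fun j => by
    rw [hq j]
    exact mul_nonneg (by positivity) (div_nonneg (by positivity)
      (Finset.prod_nonneg fun r _ => by positivity))
  have hlin : ∀ j : ℕ, ∫⁻ p in {p : ℝ × ℝ | 0 < p.2 ∧ p.2 < p.1 ∧ p.1 < 1},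
      ENNReal.ofReal (p.2 ^ (i + j) * p.1 ^ J * (1 - p.1) ^ l) = ENNReal.ofReal (q j) := by
    intro j
    rw [hq j]
    exact lintegral_triangle_monomial (i + j) l (s + j) J (by push_cast; omega)
  -- the shifts of the rational series
  obtain ⟨B, hB⟩ : ∃ B : Finset ℕ, B = (range k).image (fun t => t + 1) := ⟨_, rfl⟩
  obtain ⟨D, hD⟩ : ∃ D : Finset ℕ, D = (range (l + 1)).image (fun r => s + r + 1) := ⟨_, rfl⟩
  have hBcard : B.card = k := by
    rw [hB, card_image_of_injective _ (add_left_injective 1), card_range]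
  have hDinj : Function.Injective (fun r : ℕ => s + r + 1) := fun a b h => by
    simpa using h
  have hDcard : D.card = l + 1 := by
    rw [hD, card_image_of_injective _ hDinj, card_range]
  have hD1 : ∀ d ∈ D, 1 ≤ d := by
    intro d hd
    rw [hD] at hd
    obtain ⟨r, -, rfl⟩ := mem_image.1 hd
    omega
  -- identification of the general term with the rational series
  have hchoose : ∀ j : ℕ, ((j + k).choose k : ℝ) = (∏ b ∈ B, ((j : ℝ) + b)) / k.factorial := by
    intro j
    rw [eq_div_iff (by positivity), hB, prod_image fun a _ b _ h => by simpa using h]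
    have h := Nat.ascFactorial_eq_factorial_mul_choose j k
    rw [Nat.ascFactorial_eq_prod_range] at h
    have h' := congrArg (fun n : ℕ => (n : ℝ)) h
    push_cast at h'
    rw [show ∏ t ∈ range k, ((j : ℝ) + ((t + 1 : ℕ) : ℝ)) = ∏ t ∈ range k, ((j : ℝ) + 1 + t) from
      prod_congr rfl fun t _ => by push_cast; ring, h', mul_comm]
  have hprodD : ∀ j : ℕ, ∏ d ∈ D, ((j : ℝ) + d) =
      ∏ r ∈ range (l + 1), (((s + j : ℕ) : ℝ) + r + 1) := by
    intro j
    rw [hD, prod_image fun a _ b _ h => hDinj h]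
    exact prod_congr rfl fun r _ => by push_cast; ring
  have hform : ∀ j : ℕ, ((j + k).choose k : ℝ) * q j =
      (((l.factorial : ℚ) / k.factorial : ℚ) : ℝ) *
        ((∏ b ∈ B, ((j : ℝ) + b)) / (((j : ℝ) + ((i + 1 : ℕ) : ℕ)) * ∏ d ∈ D, ((j : ℝ) + d))) := by
    intro j
    rw [hchoose j, hq j, hprodD j,
      show ((j : ℝ) + (((i + 1 : ℕ) : ℕ) : ℝ)) = ((i + j : ℕ) : ℝ) + 1 by push_cast; ring]
    generalize ((i + j : ℕ) : ℝ) + 1 = c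
    generalize (∏ r ∈ range (l + 1), (((s + j : ℕ) : ℝ) + r + 1)) = P
    generalize (∏ b ∈ B, ((j : ℝ) + b)) = A
    push_cast
    ring
  have hsum : Summable fun j : ℕ => ((j + k).choose k : ℝ) * q j := by
    simp_rw [hform]
    exact (summable_term B D (α := i + 1) (by omega) hD1 (by omega)).mul_left _
  -- pointwise expansion on the triangle and monotone convergence
  have hpt : ∀ p ∈ ({p : ℝ × ℝ | 0 < p.2 ∧ p.2 < p.1 ∧ p.1 < 1} : Set (ℝ × ℝ)),
      HasSum (fun j : ℕ => ((j + k).choose k : ℝ) * (p.2 ^ (i + j) * p.1 ^ J * (1 - p.1) ^ l))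
        (p.2 ^ i * p.1 ^ J * (1 - p.2) ^ (-((k + 1 : ℕ) : ℤ)) * (1 - p.1) ^ l) :=
    fun p hp => hasSum_monomial i l k J hp.1 (hp.2.1.trans hp.2.2)
  have htnn : ∀ p ∈ ({p : ℝ × ℝ | 0 < p.2 ∧ p.2 < p.1 ∧ p.1 < 1} : Set (ℝ × ℝ)), ∀ j : ℕ,
      0 ≤ p.2 ^ (i + j) * p.1 ^ J * (1 - p.1) ^ l := fun p hp j =>
    mul_nonneg (mul_nonneg (pow_nonneg hp.1.le _) (zpow_nonneg (hp.1.trans hp.2.1).le _))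
      (pow_nonneg (by linarith [hp.2.2]) _)
  have hmeas_base : ∀ j : ℕ, Measurable fun p : ℝ × ℝ =>
      ENNReal.ofReal (p.2 ^ (i + j) * p.1 ^ J * (1 - p.1) ^ l) :=
    fun j => ENNReal.measurable_ofReal.comp (((measurable_snd.pow_const _).mul
      (measurable_fst.pow_const J)).mul ((measurable_const.sub measurable_fst).pow_const l))
  have hmeas_term : ∀ j : ℕ, Measurable fun p : ℝ × ℝ =>
      ENNReal.ofReal (((j + k).choose k : ℝ) * (p.2 ^ (i + j) * p.1 ^ J * (1 - p.1) ^ l)) :=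
    fun j => ENNReal.measurable_ofReal.comp ((((measurable_snd.pow_const _).mul
      (measurable_fst.pow_const J)).mul ((measurable_const.sub measurable_fst).pow_const l)).const_mul _)
  have hlint : ∫⁻ p in {p : ℝ × ℝ | 0 < p.2 ∧ p.2 < p.1 ∧ p.1 < 1},
      ENNReal.ofReal (p.2 ^ i * p.1 ^ J * (1 - p.2) ^ (-((k + 1 : ℕ) : ℤ)) * (1 - p.1) ^ l) =
        ENNReal.ofReal (∑' j : ℕ, ((j + k).choose k : ℝ) * q j) := by
    calc ∫⁻ p in {p : ℝ × ℝ | 0 < p.2 ∧ p.2 < p.1 ∧ p.1 < 1},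
          ENNReal.ofReal (p.2 ^ i * p.1 ^ J * (1 - p.2) ^ (-((k + 1 : ℕ) : ℤ)) * (1 - p.1) ^ l)
        = ∫⁻ p in {p : ℝ × ℝ | 0 < p.2 ∧ p.2 < p.1 ∧ p.1 < 1}, ∑' j : ℕ,
            ENNReal.ofReal (((j + k).choose k : ℝ) * (p.2 ^ (i + j) * p.1 ^ J * (1 - p.1) ^ l)) := by
          refine setLIntegral_congr_fun measurableSet_triangle fun p hp => ?_
          rw [← (hpt p hp).tsum_eq, ENNReal.ofReal_tsum_of_nonneg
            (fun j => mul_nonneg (by positivity) (htnn p hp j)) (hpt p hp).summable]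
      _ = ∑' j : ℕ, ∫⁻ p in {p : ℝ × ℝ | 0 < p.2 ∧ p.2 < p.1 ∧ p.1 < 1},
            ENNReal.ofReal (((j + k).choose k : ℝ) * (p.2 ^ (i + j) * p.1 ^ J * (1 - p.1) ^ l)) :=
          lintegral_tsum fun j => (hmeas_term j).aemeasurable
      _ = ∑' j : ℕ, ENNReal.ofReal (((j + k).choose k : ℝ) * q j) := by
          refine tsum_congr fun j => ?_
          have hsplit : ∀ p : ℝ × ℝ,
              ENNReal.ofReal (((j + k).choose k : ℝ) * (p.2 ^ (i + j) * p.1 ^ J * (1 - p.1) ^ l)) =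
                ENNReal.ofReal ((j + k).choose k : ℝ) *
                  ENNReal.ofReal (p.2 ^ (i + j) * p.1 ^ J * (1 - p.1) ^ l) :=
            fun p => ENNReal.ofReal_mul (by positivity)
          simp_rw [hsplit]
          rw [lintegral_const_mul _ (hmeas_base j), hlin j, ← ENNReal.ofReal_mul (by positivity)]
      _ = ENNReal.ofReal (∑' j : ℕ, ((j + k).choose k : ℝ) * q j) :=
          (ENNReal.ofReal_tsum_of_nonneg (fun j => mul_nonneg (by positivity) (hq0 j)) hsum).symm
  -- integrability and the value of the integral
  have hmeas : AEStronglyMeasurable (fun p : ℝ × ℝ =>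
      p.2 ^ i * p.1 ^ J * (1 - p.2) ^ (-((k + 1 : ℕ) : ℤ)) * (1 - p.1) ^ l)
      (volume.restrict {p : ℝ × ℝ | 0 < p.2 ∧ p.2 < p.1 ∧ p.1 < 1}) := by
    refine Measurable.aestronglyMeasurable ?_
    exact (((measurable_snd.pow_const i).mul (measurable_fst.pow_const J)).mul
      ((measurable_const.sub measurable_snd).pow_const _)).mul
      ((measurable_const.sub measurable_fst).pow_const l)
  have hnn : 0 ≤ᵐ[volume.restrict {p : ℝ × ℝ | 0 < p.2 ∧ p.2 < p.1 ∧ p.1 < 1}]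
      fun p : ℝ × ℝ => p.2 ^ i * p.1 ^ J * (1 - p.2) ^ (-((k + 1 : ℕ) : ℤ)) * (1 - p.1) ^ l :=
    (ae_restrict_iff' measurableSet_triangle).2 (ae_of_all _ fun p hp =>
      mul_nonneg (mul_nonneg (mul_nonneg (pow_nonneg hp.1.le _)
        (zpow_nonneg (hp.1.trans hp.2.1).le _))
        (zpow_nonneg (by linarith [hp.2.1.trans hp.2.2]) _)) (pow_nonneg (by linarith [hp.2.2]) _))
  refine ⟨⟨hmeas, (hasFiniteIntegral_iff_ofReal hnn).2 (by rw [hlint]; exact ENNReal.ofReal_lt_top)⟩,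
    ?_⟩
  rw [integral_eq_lintegral_of_nonneg_ae hnn hmeas, hlint,
    ENNReal.toReal_ofReal (tsum_nonneg fun j => mul_nonneg (by positivity) (hq0 j))]
  simp_rw [hform]
  rw [tsum_mul_left]
  exact ratCast_mul_mem_iSup_mzvSpace _
    (tsum_prod_div_prod_mem k B D hBcard (by omega) hD1 (i + 1) (by omega))

/-- **The dihedral monomial integrals of `𝔐_{0,5}` are in `ℚ + ℚ ζ(2)`** — Brown's theorem
[Brown 2009, Thm 8.2] for `|S| = 5`, in the monomial basis of simplicial coordinates: for
`i, l ≥ 0` and `J, K ∈ ℤ` with `i + J ≥ -1` and `K + l ≥ -1`, the function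
`x^i y^J (1-x)^K (1-y)^l` is absolutely integrable on the triangle `{0 < x < y < 1}` and
`∫∫_{0<x<y<1} x^i y^J (1-x)^K (1-y)^l dx dy ∈ ∑_{w ≤ 2} 𝒵_w = ℚ + ℚ ζ(2)`.
[cite: BrownENS2009, Thm 8.2] -/
theorem integral_monomial_mem (i l : ℕ) (J K : ℤ) (hJ : -1 ≤ (i : ℤ) + J) (hK : -1 ≤ K + l) :
    IntegrableOn (fun p : ℝ × ℝ => p.2 ^ i * p.1 ^ J * (1 - p.2) ^ K * (1 - p.1) ^ l)
        {p : ℝ × ℝ | 0 < p.2 ∧ p.2 < p.1 ∧ p.1 < 1} volume ∧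
      (∫ p in {p : ℝ × ℝ | 0 < p.2 ∧ p.2 < p.1 ∧ p.1 < 1},
          p.2 ^ i * p.1 ^ J * (1 - p.2) ^ K * (1 - p.1) ^ l) ∈
        ⨆ (w : ℕ) (_ : w ≤ 2), mzvSpace w := by
  obtain ⟨k, rfl | rfl⟩ := K.eq_nat_or_neg
  · exact integral_monomial_mem_of_nonneg i l k J hJ
  · cases k with
    | zero => simpa using integral_monomial_mem_of_nonneg i l 0 J hJ
    | succ k => exact integral_monomial_mem_of_neg i l k J hJ (by push_cast at hK; omega)

end GenusZeroPeriodsMZV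

end Literature.NumberTheory.Transcendental
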